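/-
Copyright (c) 2026 the pub-hodgecm-mathlib formalisation cell (harness21).  Prover seat hodgecm-mathlib-F0P2-p11 (g0) (L1 re-deal s1969∕s1970, LEAD F0P6-plan (g14)
EMIT #1 «p22» (R1-α)), Track B «K2-LIT» ∕ hLiu418 #184♮, ROAD Φ, G5-b = Φ7-3, organ (R1-α), device (a) «the big cell disintegrated along the corner line × N_χ(𝔸)»
(sequel of ★ p861153 ∕ p861210 ∕ p861243 ∕ p861293 ∕ p861327).  THEOREMS ONLY.
-/
import Summits.HodgeConjecture.HodgeConjecture.Theorems.K2LiuRankOneUnfolding   -- ★ p861153 (+ ★ FILE C p860139, ★ FILE A p860018, FILE B p860079, ★ α2d-2, Literature `SemidirectHaar`)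
import HarnessLib

/-!
# Crux `HLiu418`, ROAD Φ, organ Φ7-3 (R1-α), device (a): THE HAAR MEASURE OF `N_Δ(𝔸)` DISINTEGRATES ALONG `N_Δ(𝔸) = n₂(𝔸_{L⁺}) · N_χ(𝔸)`, AND THE BIG CELL
# `W_S(f)(h) = ∫ conj ψ_S(u) f(w_Δ u h) dνN = c • ∫_{𝔸_{L⁺}} conj ψ_S(n₂ t) · (∫_{N_χ(𝔸)} f(w_Δ z (n₂ t · h)) dμ_Z(z)) dμ(t)` for `ψ_S` trivial on `N_χ(𝔸)`

Cell `hodgecm-mathlib`, crux item hLiu418 = `stmt-HodgeConjecture-24832` (helper lane, count-neutral); squad K2 ∕ K2Liu, LEAD F0P6-plan (g14), desk (R1-α)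
K2E5-p17 (g8); prover F0P2-p11 (g0).  THEOREMS ONLY (no `def`, no `instance`, no notation, no named-fact hypothesis, no `sorry`).

WHY (census K2E5-p17 (g7) `CENSUS-G5b-RankOneTermPackage` 4a4be154eb368c66 §2 (R1-α) (a) «`W_S(f_s) = W⁽¹⁾_μ(M_{X₁₂} F_s)` — Fubini on `N_Δ(𝔸) = X₁₁ × X₁₂ × X₂₂`»).
The `S`-th Fourier coefficient of `E^Δ` is `W_S + MID_S` (★ Φ2); (R1-α)(b) (the middle term, ★ p861327) is done; the big cell `W_S(f)(h) = ∫_{N_Δ(𝔸)} conj ψ_S(u) f(w_Δ u h) dνN`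
(★ Φ1 `whittakerDelta`) is a plain integral over `N_Δ(𝔸)` — no lattice, no covering weight — and what it needs is the PRODUCT DISINTEGRATION of the Haar measure of the
commutative group `N_Δ(𝔸)` along the internal topological semidirect (here: direct) product `N_Δ(𝔸) = A · Z`, `A = n₂(𝔸_{L⁺})` the corner line, `Z = N_χ(𝔸)` (the structure
built inside ★ FILE C ∕ ★ p861153 from FILE B's corner subgroup and ★ FILE A's retraction lemma):
* §1 (generic) `exists_semidirect_integral` — for `B = A · Z` (`IsTopSemidirect`) and Haar measures `μA, μZ, μB` there is ONE `c ∈ (0, ∞)` with (LIN) `∫⁻ f dμB = c · ∫⁻_A ∫⁻_Z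
  f(a z)` for measurable `f ≥ 0` (Literature ★ `IsTopSemidirect.lintegral_eq_mul_lintegral_prod`'s proof) AND (BOCH) for every `μB`-integrable Banach-valued `φ`:
  `(a, z) ↦ φ(a z)` is `μA ⊗ μZ`-integrable, `a ↦ ∫_Z φ(a z) dμZ` is `μA`-integrable, and `∫ φ dμB = c • ∫_A ∫_Z φ(a z) dμZ dμA` — the SAME `c` for both clauses.
* §2 **`exists_corner_disintegration`** — the datum of #41 (`n = 2`, FILE C's binders VERBATIM): the corner one-parameter subgroup `n₂` (frame coordinate `single 1 1 ((t ⊗ 1)δ)`,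
  rational on `L⁺`), the closed subgroup `Z ≤ N_Δ(𝔸)` with the membership law `u ∈ Z ↔ w₀ u w₀⁻¹ ∈ P_Δ` (= `N_χ(𝔸)`, ★ α2d-2 `stabilizer_reflStd_iff`), a Haar measure `μZ` on `Z`
  and ONE `c ∈ (0, ∞)` with, for the Haar measure `νN` and the additive Haar measure `μ` on `𝔸_{L⁺}`: (LIN) `∫⁻ Φ dνN = c · ∫⁻ ∫⁻_Z Φ(n₂ t · z) dμZ dμ(t)` and (BOCH)
  `∫ φ dνN = c • ∫ (∫_Z φ(n₂ t · z) dμZ) dμ(t)` (+ the integrability transfers).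
* §3 **`exists_whittakerDelta_eq_corner_integral`** — (R1-α)(a) for an index whose character is trivial on `N_χ(𝔸)` (CORNER letter, as in ★ p861153 §2): for every continuous `f`
  with `u ↦ f(w_Δ u h)` `νN`-integrable, `W_S(f)(h) = c • ∫_{𝔸_{L⁺}} conj ψ_S(n₂ t) · (∫_Z f(w_Δ · z · (n₂ t · h)) dμZ(z)) dμ(t)` (`N_Δ(𝔸)` is commutative, ★
  `mul_comm_of_mem_unipDelta`; the twist is unimodular).  The inner `Z`-integral is the intertwining-type integral of `f` along `N_χ(𝔸)` («`M_{X₁₂} ∘ M_{X₂₂}`» of the census);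
  reading the outer integral as the inner-line `W⁽¹⁾_μ` is carrier «A» work ((R1-γ)∕(T4)).
References: [MoeglinWaldspurger1995] II.1.7; [KudlaRallis1994] §2; [Shimura1997] §18.4–18.5; [Weil1940] §9; Bourbaki *Intégration* VII §2 no. 9; [DeitmarEchterhoff2014] §1.5.
HONEST LABEL.  Count-neutral helper: `HC_CM` is proved only modulo the 7 printed citations (2 remaining named inputs: hLiu418 = `stmt-HodgeConjecture-24832`,
h413 = `stmt-HodgeConjecture-24833`) until rung 0 closes.
-/

set_option autoImplicit false
set_option linter.dupNamespace false -- the mandated namespace repeats `HodgeConjecture.HodgeConjecture`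

noncomputable section

open scoped Matrix ENNReal NNReal
open NumberField IsDedekindDomain MeasureTheory MeasureTheory.Measure Filter Set Function Topology
open Literature.NumberTheory.Automorphic Literature.NumberTheory.Automorphic.UnitaryGroup Literature.NumberTheory.GaloisRepresentations
open Literature.NumberTheory.GelbartRogawski1991 Literature.NumberTheory.GelbartRogawski1991.GRConstruction
open Literature.NumberTheory.K2Lit.SiegelDoubled Literature.MeasureTheory.Group
open Literature.NumberTheory.GelbartRogawski1991.AdaptedBlocks
open UnitaryDualPair
open Summit.HodgeConjecture.HodgeConjecture.Cruxes.HLiu418.K2LiuCoveringWeightSemidirectUnfold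
open Summit.HodgeConjecture.HodgeConjecture.Cruxes.HLiu418.K2LiuUnipDeltaCornerCoordinates
open Summit.HodgeConjecture.HodgeConjecture.Cruxes.HLiu418.K2LiuSiegelUnipotentCharacters (toBlocks₁₂_blk_mul toBlocks₁₂_blk_one toBlocks₁₂_blk_inv continuous_toBlocks₁₂_blk)
open Summit.HodgeConjecture.HodgeConjecture.Cruxes.HLiu418.K2LiuConstantTermMiddleCellOrbits (stabilizer_reflStd_iff)
open Summit.HodgeConjecture.HodgeConjecture.Cruxes.HLiu418.K2LiuSiegelUnipotentHaarPinned (locallyCompactSpace_unipDelta secondCountableTopology_unipDelta)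
open Summit.HodgeConjecture.HodgeConjecture.Cruxes.HLiu418.K2LiuUnipotentCocompact (exists_isCompact_cover_unipDelta)
open Summit.HodgeConjecture.HodgeConjecture.Cruxes.HLiu418.K2LiuUnipotentCoveringWeight (countable_unipDeltaRat finite_unipDeltaRat_smul_mem)
open Summit.HodgeConjecture.HodgeConjecture.Cruxes.HLiu418.K2LiuSiegelDoubledRationalMultiplicity (finite_ratH_inter)
open Summit.HodgeConjecture.HodgeConjecture.Cruxes.HLiu418.K2LiuMiddleInnerSectionUnfold (isHaarMeasure_map_of_homeomorph_add exists_cornerHom)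
open Summit.HodgeConjecture.HodgeConjecture.Cruxes.HLiu418.K2LiuSiegelUnipotentCharacters (unipDeltaChar_mul continuous_unipDeltaChar)
open Summit.HodgeConjecture.HodgeConjecture.Cruxes.HLiu418.K2LiuSiegelUnipotentFourierDefs (unipDeltaChar whittakerDelta whittakerDelta_def norm_conj_unipDeltaChar_mul norm_coe_unipDeltaChar)
open scoped ComplexConjugate

namespace Summit.HodgeConjecture.HodgeConjecture.Cruxes.HLiu418.K2LiuRankOneBigCellUnfold

/-! ## §1 Integration in semidirect coordinates: one constant for Tonelli and for Bochner -/

section Semidirect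

variable {B : Type*} [Group B] [TopologicalSpace B] [IsTopologicalGroup B] [T2Space B] [SecondCountableTopology B] [LocallyCompactSpace B]
  [MeasurableSpace B] [BorelSpace B] {A Z : Subgroup B} {eAZ : ↥A × ↥Z ≃ₜ B}
  (μA : Measure A) (μZ : Measure Z) [IsHaarMeasure μA] [IsHaarMeasure μZ] (μB : Measure B) [IsHaarMeasure μB]

/-- **INTEGRATION IN SEMIDIRECT COORDINATES, `[0, ∞]`-valued AND Bochner, with ONE constant**: for `B = A · Z` (`IsTopSemidirect`) and Haar measures `μA, μZ, μB`,
`μB = c · e_*(μA ⊗ μZ)` for some `c ∈ (0, ∞)` (Haar uniqueness, Literature ★ `IsTopSemidirect.isHaarMeasure_map`), whence (LIN) `∫⁻ f dμB = c · ∫⁻_A ∫⁻_Z f(a z) dμZ dμA` (Tonelli) and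
(BOCH) for `μB`-integrable `φ`: integrability of `(a, z) ↦ φ(a z)` and of `a ↦ ∫_Z φ(a z) dμZ`, and `∫ φ dμB = c • ∫_A ∫_Z φ(a z) dμZ dμA` (Fubini).
[cite: DeitmarEchterhoff2014, §1.5] [cite: MoeglinWaldspurger1995, II.1.7] -/
theorem exists_semidirect_integral (h : IsTopSemidirect A Z eAZ) :
    ∃ c : ℝ≥0∞, c ≠ 0 ∧ c ≠ ∞ ∧
      (∀ f : B → ℝ≥0∞, Measurable f → ∫⁻ b, f b ∂μB = c * ∫⁻ a, ∫⁻ z, f ((a : B) * (z : B)) ∂μZ ∂μA) ∧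
      ∀ {E : Type*} [NormedAddCommGroup E] [NormedSpace ℝ E] [CompleteSpace E] (φ : B → E), Integrable φ μB →
        Integrable (fun p : ↥A × ↥Z => φ ((p.1 : B) * (p.2 : B))) (μA.prod μZ) ∧
        Integrable (fun a : A => ∫ z, φ ((a : B) * (z : B)) ∂μZ) μA ∧
        ∫ b, φ b ∂μB = c.toReal • ∫ a, ∫ z, φ ((a : B) * (z : B)) ∂μZ ∂μA := by
  haveI := h.isHaarMeasure_map μA μZ
  haveI : SecondCountableTopology ↥A := TopologicalSpace.Subtype.secondCountableTopology (A : Set B)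
  haveI : SecondCountableTopology ↥Z := TopologicalSpace.Subtype.secondCountableTopology (Z : Set B)
  haveI : LocallyCompactSpace ↥A := h.isClosed_left.locallyCompactSpace
  haveI : LocallyCompactSpace ↥Z := h.isClosed_right.locallyCompactSpace
  have he : Measurable eAZ := eAZ.continuous.measurable
  -- Haar uniqueness, read with the `ℝ≥0∞`-action (definitionally the `ℝ≥0`-action of `isMulLeftInvariant_eq_smul`)
  have hμ : μB = ((haarScalarFactor μB ((μA.prod μZ).map eAZ) : ℝ≥0) : ℝ≥0∞) • (μA.prod μZ).map eAZ := isMulLeftInvariant_eq_smul μB _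
  have hc0 : ((haarScalarFactor μB ((μA.prod μZ).map eAZ) : ℝ≥0) : ℝ≥0∞) ≠ 0 := by
    exact_mod_cast (haarScalarFactor_pos_of_isHaarMeasure μB ((μA.prod μZ).map eAZ)).ne'
  refine ⟨haarScalarFactor μB ((μA.prod μZ).map eAZ), hc0, ENNReal.coe_ne_top, fun f hf => ?_, fun φ hφ => ?_⟩
  · calc ∫⁻ b, f b ∂μB
        = ∫⁻ b, f b ∂(((haarScalarFactor μB ((μA.prod μZ).map eAZ) : ℝ≥0) : ℝ≥0∞) • (μA.prod μZ).map eAZ) := by rw [← hμ]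
      _ = haarScalarFactor μB ((μA.prod μZ).map eAZ) * ∫⁻ p, (f ∘ eAZ) p ∂(μA.prod μZ) := by
          rw [lintegral_smul_measure, lintegral_map hf he, smul_eq_mul]
          rfl
      _ = haarScalarFactor μB ((μA.prod μZ).map eAZ) * ∫⁻ a, ∫⁻ z, f ((a : B) * (z : B)) ∂μZ ∂μA := by
          rw [lintegral_prod _ (hf.comp he).aemeasurable]
          congr 1
          refine lintegral_congr fun a => lintegral_congr fun z => ?_
          rw [Function.comp_apply, h.apply_eq]
  · have hcomp : (fun p : ↥A × ↥Z => φ ((p.1 : B) * (p.2 : B))) = φ ∘ eAZ := by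
      funext p
      rw [Function.comp_apply, h.apply_eq]
    -- integrability on the product, through `μB = c • e_*(μA ⊗ μZ)` and the measurable equivalence underlying `eAZ`
    have hφ' : Integrable φ ((μA.prod μZ).map eAZ) := by
      rw [hμ] at hφ
      exact (integrable_smul_measure hc0 ENNReal.coe_ne_top).1 hφ
    have hprod : Integrable (fun p : ↥A × ↥Z => φ ((p.1 : B) * (p.2 : B))) (μA.prod μZ) := by
      rw [hcomp]
      have h1 := (integrable_map_equiv eAZ.toMeasurableEquiv φ).1 (by rw [Homeomorph.toMeasurableEquiv_coe]; exact hφ')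
      rw [Homeomorph.toMeasurableEquiv_coe] at h1
      exact h1
    refine ⟨hprod, hprod.integral_prod_left, ?_⟩
    have h2 := integral_map_equiv (μ := μA.prod μZ) eAZ.toMeasurableEquiv φ
    rw [Homeomorph.toMeasurableEquiv_coe] at h2
    calc ∫ b, φ b ∂μB
        = ∫ b, φ b ∂(((haarScalarFactor μB ((μA.prod μZ).map eAZ) : ℝ≥0) : ℝ≥0∞) • (μA.prod μZ).map eAZ) := by rw [← hμ]
      _ = ((haarScalarFactor μB ((μA.prod μZ).map eAZ) : ℝ≥0) : ℝ≥0∞).toReal • ∫ p, φ (eAZ p) ∂(μA.prod μZ) := by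
          rw [integral_smul_measure, h2]
      _ = ((haarScalarFactor μB ((μA.prod μZ).map eAZ) : ℝ≥0) : ℝ≥0∞).toReal • ∫ a, ∫ z, φ ((a : B) * (z : B)) ∂μZ ∂μA := by
          rw [← integral_prod _ hprod]
          congr 1
          exact integral_congr_ae (ae_of_all _ fun p => (congrFun hcomp p).symm)

end Semidirect

variable (L : Type) [Field L] [NumberField L] [IsCMField L]
variable {N M : ℕ} (e : Fin N × Fin M ≃ Fin 2)
  (dV : Fin N → L) (hdV : ∀ i, IsCMField.complexConj L (dV i) = dV i)
  (dW : Fin M → L) (hdW : ∀ i, IsCMField.complexConj L (dW i) = dW i)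

/-! ## §2 The datum of #41: `νN` disintegrates along the corner line × `N_χ(𝔸)` -/

set_option maxHeartbeats 1600000 in -- the corner-line ∕ `N_χ(𝔸)` construction of ★ FILE C, re-run to expose the semidirect structure (same assembly size as FILE C)
/-- **THE HAAR MEASURE OF `N_Δ(𝔸)` IN CORNER COORDINATES.**  For a Haar measure `νN` on `N_Δ(𝔸)` and an additive Haar measure `μ` on `𝔸_{L⁺}` there are: the corner one-parameter
subgroup `n₂` (continuous, additive, frame coordinate `single 1 1 ((t ⊗ 1)δ)`, rational on `L⁺` — FILE B), the closed subgroup `Z ≤ N_Δ(𝔸)` with the membership law `u ∈ Z ↔ w₀ u w₀⁻¹ ∈ P_Δ`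
(`= N_χ(𝔸)`), a Haar measure `μZ` on `Z` and ONE `c ∈ (0, ∞)` such that (LIN) `∫⁻ Φ(u) dνN = c · ∫⁻ ∫⁻_Z Φ(n₂ t · z) dμZ dμ(t)` for measurable `Φ : H(𝔸) → [0, ∞]` (along `N_Δ(𝔸)`), and (BOCH)
for every Banach-valued `φ` with `u ↦ φ(u)` `νN`-integrable: `t ↦ ∫_Z φ(n₂ t · z) dμZ` is `μ`-integrable and `∫ φ(u) dνN(u) = c • ∫ (∫_Z φ(n₂ t · z) dμZ(z)) dμ(t)`.
[cite: MoeglinWaldspurger1995, II.1.7] [cite: DeitmarEchterhoff2014, §1.5] -/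
theorem exists_corner_disintegration (hdV0 : ∀ i, dV i ≠ 0) (hdW0 : ∀ i, dW i ≠ 0)
    {g₀ : UnitaryGroup.rationalPair (Fp L) L (IsCMField.complexConj L) N M (Matrix.diagonal dV) (Matrix.diagonal dW)}
    (hg₀ : ((g₀ : GL (Fin N × Fin M) L) : Matrix (Fin N × Fin M) (Fin N × Fin M) L) = Matrix.diagonal (fun k => 1 - 2 * (![0, 1] : Fin 2 → L) (e k)))
    (Λ : GL (Fin 2) (AdeleRing (𝓞 L) L) →* HA L e dV hdV dW hdW)
    (hΛ : ∀ g : GL (Fin 2) (AdeleRing (𝓞 L) L), blk L e dV hdV dW hdW (Λ g) =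
      cayR (AdeleRing (𝓞 L) L) (Fin 2) * Matrix.fromBlocks (g : Matrix (Fin 2) (Fin 2) (AdeleRing (𝓞 L) L)) 0 0
        (((gramR L e dV hdV dW hdW).map ((algebraMap L (AdeleRing (𝓞 L) L)).comp (algebraMap (Fp L) L)))⁻¹ *
          (((g⁻¹ : GL (Fin 2) (AdeleRing (𝓞 L) L)) : Matrix (Fin 2) (Fin 2) (AdeleRing (𝓞 L) L)).map
            (conjAdele (Fp L) L (IsCMField.complexConj L)))ᵀ *
          (gramR L e dV hdV dW hdW).map ((algebraMap L (AdeleRing (𝓞 L) L)).comp (algebraMap (Fp L) L))) *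
        cayRinv (AdeleRing (𝓞 L) L) (Fin 2))
    [MeasurableSpace (unipDelta L e dV hdV dW hdW)] [BorelSpace (unipDelta L e dV hdV dW hdW)]
    (νN : Measure (unipDelta L e dV hdV dW hdW)) [IsHaarMeasure νN]
    [MeasurableSpace (AdeleRing (𝓞 (Fp L)) (Fp L))] [BorelSpace (AdeleRing (𝓞 (Fp L)) (Fp L))]
    (μ : Measure (AdeleRing (𝓞 (Fp L)) (Fp L))) [μ.IsAddHaarMeasure] :
    ∃ (n₂ : AdeleRing (𝓞 (Fp L)) (Fp L) → HA L e dV hdV dW hdW) (Z : Subgroup (unipDelta L e dV hdV dW hdW)) (μZ : Measure Z) (c : ℝ≥0∞),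
      Continuous n₂ ∧ (∀ s t, n₂ (s + t) = n₂ s * n₂ t) ∧ (∀ t, n₂ t ∈ unipDelta L e dV hdV dW hdW) ∧
      (∀ t, (blk L e dV hdV dW hdW (n₂ t)).toBlocks₁₂ =
        Matrix.single (1 : Fin 2) (1 : Fin 2) (AdeleRing.baseChange (Fp L) L t * algebraMap L (AdeleRing (𝓞 L) L) (imagUnit L))) ∧
      (∀ t : Fp L, n₂ (algebraMap (Fp L) (AdeleRing (𝓞 (Fp L)) (Fp L)) t) ∈ ratH L e dV hdV dW hdW) ∧
      (∀ u : unipDelta L e dV hdV dW hdW, u ∈ Z ↔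
        IsSiegelDelta L e dV hdV dW hdW (iotaGG L e dV hdV dW hdW (1, UnitaryGroup.rationalPairToAdelic (Fp L) L (IsCMField.complexConj L) N M (Matrix.diagonal dV) (Matrix.diagonal dW) g₀) * (u : HA L e dV hdV dW hdW) * (iotaGG L e dV hdV dW hdW (1, UnitaryGroup.rationalPairToAdelic (Fp L) L (IsCMField.complexConj L) N M (Matrix.diagonal dV) (Matrix.diagonal dW) g₀))⁻¹)) ∧
      IsHaarMeasure μZ ∧ c ≠ 0 ∧ c ≠ ∞ ∧
      (∀ Φ : HA L e dV hdV dW hdW → ℝ≥0∞, Measurable (fun u : unipDelta L e dV hdV dW hdW => Φ (u : HA L e dV hdV dW hdW)) →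
        ∫⁻ u, Φ (u : HA L e dV hdV dW hdW) ∂νN = c * ∫⁻ t, ∫⁻ z, Φ (n₂ t * ((z : unipDelta L e dV hdV dW hdW) : HA L e dV hdV dW hdW)) ∂μZ ∂μ) ∧
      ∀ {E : Type*} [NormedAddCommGroup E] [NormedSpace ℝ E] [CompleteSpace E] (φ : HA L e dV hdV dW hdW → E),
        Integrable (fun u : unipDelta L e dV hdV dW hdW => φ (u : HA L e dV hdV dW hdW)) νN →
        Integrable (fun t => ∫ z, φ (n₂ t * ((z : unipDelta L e dV hdV dW hdW) : HA L e dV hdV dW hdW)) ∂μZ) μ ∧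
        ∫ u, φ (u : HA L e dV hdV dW hdW) ∂νN = c.toReal • ∫ t, ∫ z, φ (n₂ t * ((z : unipDelta L e dV hdV dW hdW) : HA L e dV hdV dW hdW)) ∂μZ ∂μ := by
  classical
  haveI : T2Space (InfiniteAdeleRing L) := inferInstanceAs (T2Space ((v : InfinitePlace L) → v.Completion))
  haveI : T2Space (FiniteAdeleRing (𝓞 L) L) :=
    inferInstanceAs (T2Space (RestrictedProduct (fun v : HeightOneSpectrum (𝓞 L) => v.adicCompletion L)
      (fun v => (v.adicCompletionIntegers L : Set (v.adicCompletion L))) Filter.cofinite))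
  haveI : T2Space (AdeleRing (𝓞 L) L) := inferInstanceAs (T2Space (InfiniteAdeleRing L × FiniteAdeleRing (𝓞 L) L))
  haveI : T1Space (Multiplicative (AdeleRing (𝓞 L) L)) := inferInstanceAs (T1Space (AdeleRing (𝓞 L) L))
  haveI : LocallyCompactSpace (unipDelta L e dV hdV dW hdW) := locallyCompactSpace_unipDelta L e dV hdV dW hdW
  haveI : SecondCountableTopology (unipDelta L e dV hdV dW hdW) := secondCountableTopology_unipDelta L e dV hdV dW hdW
  haveI : Countable (unipDeltaRat L e dV hdV dW hdW) := countable_unipDeltaRat L e dV hdV dW hdW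
  have hcommB : ∀ u v : unipDelta L e dV hdV dW hdW, u * v = v * u := fun u v => Subtype.ext (mul_comm_of_mem_unipDelta L e dV hdV dW hdW u.2 v.2)
  obtain ⟨n₂, hn₂c, hn₂add, hn₂0, hn₂mem, hn₂X, hn₂rat, -⟩ := exists_cornerSubgroup L e dV hdV dW hdW hdV0 hdW0
  obtain ⟨κ, hκc, hκ⟩ := exists_cornerHom L e dV hdV dW hdW
  have hker : ∀ u : unipDelta L e dV hdV dW hdW, u ∈ κ.ker ↔ (blk L e dV hdV dW hdW (u : HA L e dV hdV dW hdW)).toBlocks₁₂ 1 1 = 0 := fun u => by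
    rw [MonoidHom.mem_ker, hκ u, ofAdd_eq_one]
  have hZlaw : ∀ u : unipDelta L e dV hdV dW hdW, u ∈ κ.ker ↔
      IsSiegelDelta L e dV hdV dW hdW
        (iotaGG L e dV hdV dW hdW (1, UnitaryGroup.rationalPairToAdelic (Fp L) L (IsCMField.complexConj L) N M (Matrix.diagonal dV) (Matrix.diagonal dW) g₀) *
          (u : HA L e dV hdV dW hdW) *
          (iotaGG L e dV hdV dW hdW (1, UnitaryGroup.rationalPairToAdelic (Fp L) L (IsCMField.complexConj L) N M (Matrix.diagonal dV) (Matrix.diagonal dW) g₀))⁻¹) :=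
    fun u => by rw [hker, stabilizer_reflStd_iff hg₀ Λ hΛ u.2]
  let n₂B : AdeleRing (𝓞 (Fp L)) (Fp L) → unipDelta L e dV hdV dW hdW := fun t => ⟨n₂ t, hn₂mem t⟩
  have hn₂Bc : Continuous n₂B := hn₂c.subtype_mk _
  have hn₂Badd : ∀ s t, n₂B (s + t) = n₂B s * n₂B t := fun s t => Subtype.ext (hn₂add s t)
  have hn₂B0 : n₂B 0 = 1 := Subtype.ext hn₂0
  let im : AdeleRing (𝓞 L) L → AdeleRing (𝓞 (Fp L)) (Fp L) := fun x =>
    ((quadraticAdeleEquiv (Fp L) L (IsCMField.complexConj L) (complexConj_imagUnit L) (imagUnit_ne_zero L)).symm x).2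
  have himc : Continuous im := continuous_im L
  have hX11n₂ : ∀ t, (blk L e dV hdV dW hdW (n₂ t)).toBlocks₁₂ 1 1 = AdeleRing.baseChange (Fp L) L t * algebraMap L (AdeleRing (𝓞 L) L) (imagUnit L) := fun t => by
    rw [hn₂X, Matrix.single_apply_same]
  have him_n₂ : ∀ t, im ((blk L e dV hdV dW hdW (n₂ t)).toBlocks₁₂ 1 1) = t := fun t => by
    rw [hX11n₂]
    exact im_baseChange_mul_delta L t
  let ρ₀ : unipDelta L e dV hdV dW hdW → unipDelta L e dV hdV dW hdW := fun u => n₂B (im ((blk L e dV hdV dW hdW (u : HA L e dV hdV dW hdW)).toBlocks₁₂ 1 1))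
  have hX11c : Continuous fun u : unipDelta L e dV hdV dW hdW => (blk L e dV hdV dW hdW (u : HA L e dV hdV dW hdW)).toBlocks₁₂ 1 1 :=
    ((continuous_toBlocks₁₂_blk L e dV hdV dW hdW).comp continuous_subtype_val).matrix_elem 1 1
  have hρ₀c : Continuous ρ₀ := hn₂Bc.comp (himc.comp hX11c)
  have hρ₀n₂ : ∀ t, ρ₀ (n₂B t) = n₂B t := fun t => by
    show n₂B (im ((blk L e dV hdV dW hdW (n₂ t)).toBlocks₁₂ 1 1)) = n₂B t
    rw [him_n₂]
  have hX11ρ₀ : ∀ u : unipDelta L e dV hdV dW hdW,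
      (blk L e dV hdV dW hdW (ρ₀ u : HA L e dV hdV dW hdW)).toBlocks₁₂ 1 1 = (blk L e dV hdV dW hdW (u : HA L e dV hdV dW hdW)).toBlocks₁₂ 1 1 := fun u => by
    show (blk L e dV hdV dW hdW (n₂ (im _))).toBlocks₁₂ 1 1 = _
    rw [hX11n₂]
    exact baseChange_im_mul_delta L (conjAdele_toBlocks₁₂_diag_eq_neg L e dV hdV dW hdW hdV0 hdW0 u.2 1)
  let n₂H : Multiplicative (AdeleRing (𝓞 (Fp L)) (Fp L)) →* unipDelta L e dV hdV dW hdW :=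
    { toFun := fun t => n₂B (Multiplicative.toAdd t)
      map_one' := hn₂B0
      map_mul' := fun s t => hn₂Badd _ _ }
  set A : Subgroup (unipDelta L e dV hdV dW hdW) := n₂H.range with hAdef
  have hmemA : ∀ u, u ∈ A ↔ ∃ t, n₂B t = u := fun u =>
    ⟨fun ⟨t, ht⟩ => ⟨Multiplicative.toAdd t, ht⟩, fun ⟨t, ht⟩ => ⟨Multiplicative.ofAdd t, ht⟩⟩
  have hAfix : ∀ u, u ∈ A ↔ ρ₀ u = u := fun u => by
    rw [hmemA]
    constructor
    · rintro ⟨t, rfl⟩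
      exact hρ₀n₂ t
    · intro h
      exact ⟨_, h⟩
  have hAc : IsClosed (A : Set (unipDelta L e dV hdV dW hdW)) := by
    rw [show (A : Set (unipDelta L e dV hdV dW hdW)) = {u | ρ₀ u = u} from Set.ext hAfix]
    exact isClosed_eq hρ₀c continuous_id
  set Z : Subgroup (unipDelta L e dV hdV dW hdW) := κ.ker with hZdef
  have hZc : IsClosed (Z : Set (unipDelta L e dV hdV dW hdW)) := by
    rw [hZdef, MonoidHom.coe_ker]
    exact isClosed_singleton.preimage hκc
  let ρ : unipDelta L e dV hdV dW hdW → A := fun u => ⟨ρ₀ u, (hmemA _).2 ⟨_, rfl⟩⟩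
  have hρc : Continuous ρ := hρ₀c.subtype_mk _
  have hρ : ∀ (a : A) (z : Z), ρ ((a : unipDelta L e dV hdV dW hdW) * z) = a := fun a z => by
    obtain ⟨t, ht⟩ := (hmemA a).1 a.2
    apply Subtype.ext
    show n₂B (im ((blk L e dV hdV dW hdW (((a : unipDelta L e dV hdV dW hdW) * (z : unipDelta L e dV hdV dW hdW) : unipDelta L e dV hdV dW hdW) :
      HA L e dV hdV dW hdW)).toBlocks₁₂ 1 1)) = a
    rw [Subgroup.coe_mul, toBlocks₁₂_blk_mul L e dV hdV dW hdW (a : unipDelta L e dV hdV dW hdW).2 (z : unipDelta L e dV hdV dW hdW).2, Matrix.add_apply,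
      (hker _).1 z.2, add_zero, ← ht, him_n₂]
  have hρZ : ∀ b : unipDelta L e dV hdV dW hdW, ((ρ b : unipDelta L e dV hdV dW hdW))⁻¹ * b ∈ Z := fun b => by
    refine (hker _).2 ?_
    rw [Subgroup.coe_mul, Subgroup.coe_inv, toBlocks₁₂_blk_mul L e dV hdV dW hdW (inv_mem (ρ₀ b).2) b.2, toBlocks₁₂_blk_inv L e dV hdV dW hdW (ρ₀ b).2,
      Matrix.add_apply, Matrix.neg_apply, hX11ρ₀, neg_add_cancel]
  have hnorm : ∀ (a : A) (z : Z), (a : unipDelta L e dV hdV dW hdW)⁻¹ * (z : unipDelta L e dV hdV dW hdW) * a ∈ Z := fun a z => by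
    rw [hcommB _ (a : unipDelta L e dV hdV dW hdW), ← mul_assoc, mul_inv_cancel, one_mul]
    exact z.2
  have hAZ : ∀ (a : A) (z : Z), (a : unipDelta L e dV hdV dW hdW) * z = (z : unipDelta L e dV hdV dW hdW) * a := fun a z => hcommB _ _
  obtain ⟨eAZ, hsd⟩ := exists_homeomorph_isTopSemidirect_of_retraction A Z ρ hρc hρ hρZ hAc hZc hnorm
  haveI : LocallyCompactSpace Z := hZc.locallyCompactSpace
  let μZ : Measure Z := Measure.haar
  let eA : AdeleRing (𝓞 (Fp L)) (Fp L) ≃ₜ A :=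
    { toFun := fun t => ⟨n₂B t, (hmemA _).2 ⟨t, rfl⟩⟩
      invFun := fun a => im ((blk L e dV hdV dW hdW ((a : unipDelta L e dV hdV dW hdW) : HA L e dV hdV dW hdW)).toBlocks₁₂ 1 1)
      left_inv := fun t => him_n₂ t
      right_inv := fun a => Subtype.ext ((hAfix a).1 a.2)
      continuous_toFun := hn₂Bc.subtype_mk _
      continuous_invFun := himc.comp (hX11c.comp continuous_subtype_val) }
  have heA : ∀ t, (((eA t : A) : unipDelta L e dV hdV dW hdW) : HA L e dV hdV dW hdW) = n₂ t := fun t => rfl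
  haveI : IsHaarMeasure (μ.map eA) := isHaarMeasure_map_of_homeomorph_add μ eA fun s t => Subtype.ext (hn₂Badd s t)
  obtain ⟨c, hc0, hctop, hlin, hboch⟩ := exists_semidirect_integral (μ.map eA) μZ νN hsd
  have heA : ∀ t, (((eA t : A) : unipDelta L e dV hdV dW hdW) : HA L e dV hdV dW hdW) = n₂ t := fun t => rfl
  refine ⟨n₂, Z, μZ, c, hn₂c, hn₂add, hn₂mem, hn₂X, hn₂rat, fun u => hZlaw u, inferInstance, hc0, hctop, fun Φ hΦm => ?_, fun φ hφ => ?_⟩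
  · have htr := lintegral_map_equiv (μ := μ) (fun a : A => ∫⁻ z, Φ ((((a : unipDelta L e dV hdV dW hdW) * (z : unipDelta L e dV hdV dW hdW) : unipDelta L e dV hdV dW hdW) : HA L e dV hdV dW hdW)) ∂μZ) eA.toMeasurableEquiv
    rw [Homeomorph.toMeasurableEquiv_coe] at htr
    rw [hlin (fun b : unipDelta L e dV hdV dW hdW => Φ (b : HA L e dV hdV dW hdW)) hΦm, htr]
    rfl
  · obtain ⟨-, hint, heq⟩ := hboch (fun b : unipDelta L e dV hdV dW hdW => φ (b : HA L e dV hdV dW hdW)) hφ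
    have htrI := integrable_map_equiv (μ := μ) eA.toMeasurableEquiv (fun a : A => ∫ z, φ ((((a : unipDelta L e dV hdV dW hdW) * (z : unipDelta L e dV hdV dW hdW) : unipDelta L e dV hdV dW hdW) : HA L e dV hdV dW hdW)) ∂μZ)
    have htr := integral_map_equiv (μ := μ) eA.toMeasurableEquiv (fun a : A => ∫ z, φ ((((a : unipDelta L e dV hdV dW hdW) * (z : unipDelta L e dV hdV dW hdW) : unipDelta L e dV hdV dW hdW) : HA L e dV hdV dW hdW)) ∂μZ)
    rw [Homeomorph.toMeasurableEquiv_coe] at htrI htr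
    exact ⟨htrI.1 hint, heq.trans (by rw [htr]; rfl)⟩

/-! ## §3 (R1-α)(a): the big cell `W_S(f)(h)` along the corner line -/

/-- **(R1-α)(a) — THE BIG CELL IN CORNER COORDINATES.**  With `n₂`, `Z = N_χ(𝔸)`, `μZ`, `c` of `exists_corner_disintegration`: for every index `S` whose character is trivial on
`N_χ(𝔸)` (CORNER letter `∀ z ∈ N_Δ(𝔸), w₀ z w₀⁻¹ ∈ P_Δ → ψ_S(z) = 1`), every continuous `f : H(𝔸) → ℂ` with `u ↦ f(w_Δ u h)` `νN`-integrable: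
  `W_S(f)(h) = ∫ conj ψ_S(u) · f(w_Δ u h) dνN(u) = c • ∫ conj ψ_S(n₂ t) · (∫_Z f(w_Δ · z · (n₂ t · h)) dμZ(z)) dμ(t)`
(`N_Δ(𝔸)` is commutative: `n₂ t · z = z · n₂ t`; `ψ_S(n₂ t · z) = ψ_S(n₂ t)`; the twist is unimodular).  The inner integral is the `N_χ(𝔸)`-period of `f(w_Δ · y)` at `y = n₂ t · h`.
[cite: MoeglinWaldspurger1995, II.1.7] [cite: KudlaRallis1994, §2] [cite: Shimura1997, §18.4] -/
theorem exists_whittakerDelta_eq_corner_integral (hdV0 : ∀ i, dV i ≠ 0) (hdW0 : ∀ i, dW i ≠ 0)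
    {g₀ : UnitaryGroup.rationalPair (Fp L) L (IsCMField.complexConj L) N M (Matrix.diagonal dV) (Matrix.diagonal dW)}
    (hg₀ : ((g₀ : GL (Fin N × Fin M) L) : Matrix (Fin N × Fin M) (Fin N × Fin M) L) = Matrix.diagonal (fun k => 1 - 2 * (![0, 1] : Fin 2 → L) (e k)))
    (Λ : GL (Fin 2) (AdeleRing (𝓞 L) L) →* HA L e dV hdV dW hdW)
    (hΛ : ∀ g : GL (Fin 2) (AdeleRing (𝓞 L) L), blk L e dV hdV dW hdW (Λ g) =
      cayR (AdeleRing (𝓞 L) L) (Fin 2) * Matrix.fromBlocks (g : Matrix (Fin 2) (Fin 2) (AdeleRing (𝓞 L) L)) 0 0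
        (((gramR L e dV hdV dW hdW).map ((algebraMap L (AdeleRing (𝓞 L) L)).comp (algebraMap (Fp L) L)))⁻¹ *
          (((g⁻¹ : GL (Fin 2) (AdeleRing (𝓞 L) L)) : Matrix (Fin 2) (Fin 2) (AdeleRing (𝓞 L) L)).map
            (conjAdele (Fp L) L (IsCMField.complexConj L)))ᵀ *
          (gramR L e dV hdV dW hdW).map ((algebraMap L (AdeleRing (𝓞 L) L)).comp (algebraMap (Fp L) L))) *
        cayRinv (AdeleRing (𝓞 L) L) (Fin 2))
    [MeasurableSpace (unipDelta L e dV hdV dW hdW)] [BorelSpace (unipDelta L e dV hdV dW hdW)]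
    (νN : Measure (unipDelta L e dV hdV dW hdW)) [IsHaarMeasure νN]
    [MeasurableSpace (AdeleRing (𝓞 (Fp L)) (Fp L))] [BorelSpace (AdeleRing (𝓞 (Fp L)) (Fp L))]
    (μ : Measure (AdeleRing (𝓞 (Fp L)) (Fp L))) [μ.IsAddHaarMeasure] :
    ∃ (n₂ : AdeleRing (𝓞 (Fp L)) (Fp L) → HA L e dV hdV dW hdW) (Z : Subgroup (unipDelta L e dV hdV dW hdW)) (μZ : Measure Z) (c : ℝ≥0∞),
      Continuous n₂ ∧ (∀ s t, n₂ (s + t) = n₂ s * n₂ t) ∧ (∀ t, n₂ t ∈ unipDelta L e dV hdV dW hdW) ∧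
      (∀ t, (blk L e dV hdV dW hdW (n₂ t)).toBlocks₁₂ =
        Matrix.single (1 : Fin 2) (1 : Fin 2) (AdeleRing.baseChange (Fp L) L t * algebraMap L (AdeleRing (𝓞 L) L) (imagUnit L))) ∧
      (∀ t : Fp L, n₂ (algebraMap (Fp L) (AdeleRing (𝓞 (Fp L)) (Fp L)) t) ∈ ratH L e dV hdV dW hdW) ∧
      (∀ u : unipDelta L e dV hdV dW hdW, u ∈ Z ↔
        IsSiegelDelta L e dV hdV dW hdW (iotaGG L e dV hdV dW hdW (1, UnitaryGroup.rationalPairToAdelic (Fp L) L (IsCMField.complexConj L) N M (Matrix.diagonal dV) (Matrix.diagonal dW) g₀) * (u : HA L e dV hdV dW hdW) * (iotaGG L e dV hdV dW hdW (1, UnitaryGroup.rationalPairToAdelic (Fp L) L (IsCMField.complexConj L) N M (Matrix.diagonal dV) (Matrix.diagonal dW) g₀))⁻¹)) ∧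
      IsHaarMeasure μZ ∧ c ≠ 0 ∧ c ≠ ∞ ∧
      ∀ (S : Matrix (Fin 2) (Fin 2) L)
        (_ : ∀ z : HA L e dV hdV dW hdW, z ∈ unipDelta L e dV hdV dW hdW →
          IsSiegelDelta L e dV hdV dW hdW (iotaGG L e dV hdV dW hdW (1, UnitaryGroup.rationalPairToAdelic (Fp L) L (IsCMField.complexConj L) N M (Matrix.diagonal dV) (Matrix.diagonal dW) g₀) * z * (iotaGG L e dV hdV dW hdW (1, UnitaryGroup.rationalPairToAdelic (Fp L) L (IsCMField.complexConj L) N M (Matrix.diagonal dV) (Matrix.diagonal dW) g₀))⁻¹) →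
          unipDeltaChar L e dV hdV dW hdW S z = 1)
        (f : HA L e dV hdV dW hdW → ℂ) (_ : Continuous f) (h : HA L e dV hdV dW hdW)
        (_ : Integrable (fun u : unipDelta L e dV hdV dW hdW => f (weylDelta L e dV hdV dW hdW * (u : HA L e dV hdV dW hdW) * h)) νN),
        whittakerDelta L e dV hdV dW hdW νN S f h =
          c.toReal • ∫ t, conj (unipDeltaChar L e dV hdV dW hdW S (n₂ t) : ℂ) *
            (∫ z, f (weylDelta L e dV hdV dW hdW * ((z : unipDelta L e dV hdV dW hdW) : HA L e dV hdV dW hdW) * (n₂ t * h)) ∂μZ) ∂μ := by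
  obtain ⟨n₂, Z, μZ, c, hn₂c, hn₂add, hn₂mem, hn₂X, hn₂rat, hZlaw, hμZ, hc0, hctop, -, hboch⟩ :=
    exists_corner_disintegration L e dV hdV dW hdW hdV0 hdW0 hg₀ Λ hΛ νN μ
  refine ⟨n₂, Z, μZ, c, hn₂c, hn₂add, hn₂mem, hn₂X, hn₂rat, hZlaw, hμZ, hc0, hctop, fun S hS f hfc h hint => ?_⟩
  -- the twisted integrand is integrable (the twist is unimodular)
  have hψm : AEStronglyMeasurable (fun u : unipDelta L e dV hdV dW hdW => conj (unipDeltaChar L e dV hdV dW hdW S (u : HA L e dV hdV dW hdW) : ℂ)) νN :=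
    ((Complex.continuous_conj.comp (continuous_unipDeltaChar L e dV hdV dW hdW S)).comp continuous_subtype_val).aestronglyMeasurable
  have hbound : ∀ u : unipDelta L e dV hdV dW hdW, ‖conj (unipDeltaChar L e dV hdV dW hdW S (u : HA L e dV hdV dW hdW) : ℂ)‖ ≤ 1 := fun u =>
    le_of_eq (by rw [Complex.norm_conj, norm_coe_unipDeltaChar])
  have hint' : Integrable (fun u : unipDelta L e dV hdV dW hdW => conj (unipDeltaChar L e dV hdV dW hdW S (u : HA L e dV hdV dW hdW) : ℂ) * f (weylDelta L e dV hdV dW hdW * (u : HA L e dV hdV dW hdW) * h)) νN :=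
    hint.bdd_mul hψm (Filter.Eventually.of_forall hbound)
  obtain ⟨-, heq⟩ := hboch (fun x : HA L e dV hdV dW hdW => conj (unipDeltaChar L e dV hdV dW hdW S x : ℂ) * f (weylDelta L e dV hdV dW hdW * x * h)) hint'
  rw [whittakerDelta_def, heq]
  congr 1
  refine integral_congr_ae (ae_of_all _ fun t => ?_)
  -- inner integral: `ψ_S(n₂ t · z) = ψ_S(n₂ t)` and `w_Δ (n₂ t z) h = w_Δ z (n₂ t h)`
  show (∫ z, conj (unipDeltaChar L e dV hdV dW hdW S (n₂ t * ((z : unipDelta L e dV hdV dW hdW) : HA L e dV hdV dW hdW)) : ℂ) * f (weylDelta L e dV hdV dW hdW * (n₂ t * ((z : unipDelta L e dV hdV dW hdW) : HA L e dV hdV dW hdW)) * h) ∂μZ) =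
    conj (unipDeltaChar L e dV hdV dW hdW S (n₂ t) : ℂ) * ∫ z, f (weylDelta L e dV hdV dW hdW * ((z : unipDelta L e dV hdV dW hdW) : HA L e dV hdV dW hdW) * (n₂ t * h)) ∂μZ
  rw [← integral_const_mul]
  refine integral_congr_ae (ae_of_all _ fun z => ?_)
  have hz : ((z : unipDelta L e dV hdV dW hdW) : HA L e dV hdV dW hdW) ∈ unipDelta L e dV hdV dW hdW := (z : unipDelta L e dV hdV dW hdW).2
  have hψz : unipDeltaChar L e dV hdV dW hdW S ((z : unipDelta L e dV hdV dW hdW) : HA L e dV hdV dW hdW) = 1 := hS _ hz ((hZlaw (z : unipDelta L e dV hdV dW hdW)).1 z.2)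
  show conj (unipDeltaChar L e dV hdV dW hdW S (n₂ t * ((z : unipDelta L e dV hdV dW hdW) : HA L e dV hdV dW hdW)) : ℂ) * f (weylDelta L e dV hdV dW hdW * (n₂ t * ((z : unipDelta L e dV hdV dW hdW) : HA L e dV hdV dW hdW)) * h) =
    conj (unipDeltaChar L e dV hdV dW hdW S (n₂ t) : ℂ) * f (weylDelta L e dV hdV dW hdW * ((z : unipDelta L e dV hdV dW hdW) : HA L e dV hdV dW hdW) * (n₂ t * h))
  rw [unipDeltaChar_mul L e dV hdV dW hdW S (hn₂mem t) hz, hψz, mul_one, mul_comm_of_mem_unipDelta L e dV hdV dW hdW (hn₂mem t) hz,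
    mul_assoc (weylDelta L e dV hdV dW hdW) _ h, mul_assoc ((z : unipDelta L e dV hdV dW hdW) : HA L e dV hdV dW hdW) (n₂ t) h, ← mul_assoc (weylDelta L e dV hdV dW hdW)]

end Summit.HodgeConjecture.HodgeConjecture.Cruxes.HLiu418.K2LiuRankOneBigCellUnfold

end
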